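import Summits.BirchSwinnertonDyer.Rank1Residual.X4.KuriharaLevelLoweringField
import Literature.NumberTheory.EllipticCurves.ModularSymbolsRationalWeightTwo
import Literature.NumberTheory.EllipticCurves.PAdicLFunctionIntegralityAtTwoProofs
import HarnessLib

/-!
# The level-lowering certificate from mod-`p` MULTIPLICITY ONE and a NON-ZERO `ℓ`-OLD EIGENSYMBOL: the two published inputs displayed in the tree's modular-symbol currency (cell `b2b-bsdres`, seat additive-p4 gen 23, line V42)

HONEST FRAMING (verbatim, cell `b2b-bsdres`): the goal of the cell is to DELETE the COMBINATION-SHAPED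
residual classes for ALL analytic-rank `≤ 1` curves over `ℚ` — "full BSD formula for every rank `≤ 1`
curve in class `C`" assembled STRICTLY from published theorems — so that the rank-`≤ 1` remainder
becomes exactly the CONSTRUCTION-SHAPED classes, which are TYPED (missing-input Props), NOT attempted;
this is not "finishing BSD". This file: a research-route KERNEL REDUCTION (pure algebra over the tree's
`Symb_Γ(Sym⁰)` / `hecke` / `ratSymb` and the seat's certificate); the two displayed hypotheses are
predicates WITH PARAMETERS, not named facts; nothing is booked; X4 stays CONSTRUCTION-SHAPED.

## What this file does (CLASS-CLOSURE experiment type E2 "obstruction anatomy → sub-partition")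

The certificate `PlusSymbolLevelLowersAt/Over W p f (ι) ℓ` (`[r]⁺_f ≡ μ(r) − μ(ℓ r)` for a periodic
Hecke-eigen `μ`) closes the TAM-DEFECT₂ rows (`X4/KimDefectLevelLowering.lean`,
`X4/KuriharaLevelLoweringField.lean`). This file makes its provenance a THEOREM of the tree with
exactly two displayed hypotheses, both on the tree's `k`-valued weight-`2` modular symbols
`Symb_{Γ₀(N)}(Sym⁰ k)` (`ModularSymbolsCoefficients`) with their Hecke operators `hecke N q`
(`T_q` / `U_q`) and the involution `ι = diag(−1,1)`:
* **(MO) `ModPMultiplicityOne N θ`** — the `θ`-eigen, `ι`-fixed subspace has dimension `≤ 1`.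
  IN PRINT when `p ∤ 2N` and `ρ̄_θ` is absolutely irreducible (Mazur 1977; Ribet 1990 Thm. 5.2 (b);
  Mazur–Ribet; Wiles 1995 Thm. 2.1: `J₀(N)[𝔪] ≅ ρ̄_𝔪`, read on `H¹(X₀(N); k)^±` after non-Eisenstein
  localisation). NOT IN PRINT when `p² ∣ N` (class X4 read on the additive curve itself).
* **(OLD) `HasOldEigenPlusSymb N θ ℓ w μ`** — the `ℓ`-old symbol of `r ↦ μ(r) − w μ(ℓ r)` lies in that
  subspace and is NON-ZERO. IN PRINT for `θ = θ̄_f` with `ρ̄_f` absolutely irreducible and UNRAMIFIED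
  at `ℓ ∥ N` (`p ∣ c_ℓ` at a split multiplicative `ℓ`, `w = a_ℓ = 1`): Ribet 1990 Thm. 1.1 / Diamond
  1995 (`diamond1995_refinedSerre` in the tree) + `ℓ`-stabilisation + Deligne / Edixhoven 1992
  Thm. 2.5–2.6 at `T_p` + Ihara's lemma (Ribet 1984 Thm. 4.1) for the non-vanishing.
From (MO) + (OLD) + the tree's facts on `f`'s rational plus symbol (`ratSymb_mem_Symb`, `hecke_ratSymb`,
evenness, `p`-integrality of every `[r]⁺_f` — hypothesis `hint`, discharged for `E[p]` irreducible by
`Additive.norm_ratPlusSymbol_le_one_of_irreducible`): `isEigenPlusSymb_redSymb` (**`f`'s reduced plus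
symbol lies in the subspace**), `exists_ratPlusSymbol_eq_mul_oldShape_of_multiplicityOne`
(**`[r]⁺_f ≡ c·(μ(r) − w μ(ℓ r))`**), `plusSymbolLevelLowersOver_of_multiplicityOne` (**the
certificate**, `w = 1`), `exists_oldShape_of_multiplicityOne_twist` (the `V`-side input `hV` of the
twist transport `plusSymbolLevelLowersOver_of_twistSum_fn`). SUB-PARTITION recorded (seat memo
`V42-LEVEL-LOWERING-FROM-PRINT.md`): twist-good locus `e_p(W) = 2`, `V` good at `p` (`p ∤ N_V`) ⟹
(MO)+(OLD) in print for `f_V` ⟹ VERBATIM-EXTENSION; corner `e_p ∈ {3,4,6}` ⟹ (MO) at `p² ∥ N` is the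
exact missing statement ⟹ IRREDUCIBLE. Nothing booked; no fact minted; labels unchanged.

## References

* B. Mazur, Publ. Math. IHÉS 47 (1977), Prop. II.14.2. [cite: Mazur1977, Prop. II.14.2]
* K. A. Ribet, Invent. Math. 100 (1990) 431–476, Thm. 1.1 and Thm. 5.2 (b). [cite: Ribet1990, Thm. 1.1 and Thm. 5.2 (b)]
* A. Wiles, Ann. of Math. 141 (1995) 443–551, Thm. 2.1. [cite: Wiles1995, Thm. 2.1]
* K. A. Ribet, Proc. ICM 1983 (1984), Thm. 4.1 (Ihara's lemma). [cite: Ribet1984ICM, Thm. 4.1]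
* F. Diamond, *The refined conjecture of Serre* (1995), Thm. 1.1. [cite: Diamond1995RefinedSerre, Thm. 1.1]
* B. Edixhoven, Invent. Math. 109 (1992), Thm. 2.5–2.6. [cite: Edixhoven1992, Thm. 2.5 and 2.6]
* B. Mazur, J. Tate, J. Teitelbaum, Invent. Math. 84 (1986), §I.4 (4.2), §I.8 [cite: MazurTateTeitelbaum1986Invent, §I.4 (4.2) and §I.8]; C.-H. Kim, Amer. J. Math. 148 (2026), §1.2.2, §1.4.3, Conj. 1.10. [cite: Kim2022StructureSelmer, §1.2.2, §1.4.3 and Conj. 1.10]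
-/

noncomputable section

open scoped MatrixGroups ModularForm

open CongruenceSubgroup Finset Matrix

open Literature.NumberTheory.EllipticCurves Literature.NumberTheory.EllipticCurves.ModularForms
  Literature.NumberTheory.EllipticCurves.ModularForms.HidaCohomology

namespace Summit.BirchSwinnertonDyer.Rank1Residual.LevelLowering

variable {k : Type*} [CommRing k]

/-! ### §1 Potentials, the eigen-plus subspace, and the two displayed hypotheses -/

section Predicates

open Classical in
/-- The potential `P¹(ℚ) → k` of a function `φ : ℚ → k`: `φ(r)` at the finite cusp `r`, `0` at `∞`
(the shape of the tree's `ratPot`). [cite: MazurTateTeitelbaum1986Invent, §I.8] -/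
def potOf (φ : ℚ → k) (x : P1Q) : k :=
  if h : ∃ r : ℚ, x = P1Q.ofRat r then φ h.choose else 0

/-- `potOf φ ∞ = 0`. [folklore] -/
theorem potOf_infty (φ : ℚ → k) : potOf φ P1Q.infty = 0 := by
  unfold potOf; rw [dif_neg fun ⟨r, hr⟩ ↦ ofRat_ne_infty r hr.symm]

/-- `potOf φ r = φ r` at a finite cusp. [folklore] -/
theorem potOf_ofRat (φ : ℚ → k) (r : ℚ) : potOf φ (P1Q.ofRat r) = φ r := by
  have hx : ∃ r' : ℚ, P1Q.ofRat r = P1Q.ofRat r' := ⟨r, rfl⟩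
  have hr : hx.choose = r := (ofRat_injective hx.choose_spec).symm
  unfold potOf
  rw [dif_pos hx, hr]

/-- **The `Sym⁰ k`-valued symbol of a function `φ : ℚ → k`**: `(x, y) ↦ potOf φ y − potOf φ x`
("`Φ({y} − {x})`"; the shape of the tree's `ratSymb`). [cite: MazurTateTeitelbaum1986Invent, §I.8] -/
def potSymbOf (φ : ℚ → k) : P1Q → P1Q → (Fin 1 → k) := fun x y _ ↦ potOf φ y - potOf φ x

/-- Unfolding `potSymbOf`. [folklore] -/
@[simp] theorem potSymbOf_apply (φ : ℚ → k) (x y : P1Q) (i : Fin 1) :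
    potSymbOf φ x y i = potOf φ y - potOf φ x := rfl

/-- `potSymbOf φ (∞, r) = φ r`. [folklore] -/
theorem potSymbOf_infty_ofRat (φ : ℚ → k) (r : ℚ) (i : Fin 1) :
    potSymbOf φ P1Q.infty (P1Q.ofRat r) i = φ r := by
  rw [potSymbOf_apply, potOf_ofRat, potOf_infty, sub_zero]

variable (k) in
/-- **The `θ`-eigen, `ι`-fixed subspace of `Symb_{Γ₀(N)}(Sym⁰ k)`** as a predicate: `Φ` is a
`Γ₀(N)`-invariant additive function of pairs of cusps (the tree's `Symb` for the `Sym⁰` coefficient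
system on `Σ₀(N)`), `T_q Φ = θ(q)·Φ` for EVERY prime `q` (the tree's `hecke N q`: `T_q` for `q ∤ N`,
`U_q` for `q ∣ N`), and `Φ|ι = Φ` for `ι = diag(−1, 1)` (the plus part). Over `k ⊇ 𝔽_p` with
`θ = θ̄_f` this is the `(𝔪_f, +)`-eigenspace of mod-`p` weight-`2` modular symbols of level `N`.
A predicate; nothing asserted. [cite: Ribet1990, Thm. 5.2 (b)] [cite: Wiles1995, Thm. 2.1] -/
def IsEigenPlusSymb (N : ℕ) (θ : ℕ → k) (Φ : P1Q → P1Q → (Fin 1 → k)) : Prop :=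
  Φ ∈ (CoeffActionOn.symPowOn (sigma0Set N) 0 k).Symb (Gamma0 N) ∧
    (∀ (q : ℕ) [NeZero q], q.Prime → (CoeffActionOn.symPowOn (sigma0Set N) 0 k).hecke N q Φ = θ q • Φ) ∧
    (CoeffActionOn.symPowOn (sigma0Set N) 0 k).slash iotaMat Φ = Φ

variable (k) in
/-- **(MO) mod-`p` MULTIPLICITY ONE for the `θ`-eigen plus symbols of level `N`**: the subspace
`IsEigenPlusSymb k N θ` has dimension `≤ 1` — every member is a `k`-multiple of every NON-ZERO member.
IN PRINT (for `k ⊇ 𝔽_p`, `θ = θ̄_f`, `ρ̄_f` absolutely irreducible) when `p ∤ 2N`: Mazur 1977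
Prop. II.14.2 (prime `N`), Ribet 1990 Thm. 5.2 (b), Mazur–Ribet 1991, Wiles 1995 Thm. 2.1
("`J₀(N)[𝔪]` is one copy of `ρ̄_𝔪`"), read on `H¹(X₀(N); k)^± ≅ Symb^±` after localisation at the
non-Eisenstein `𝔪` (verbatim for `p ≥ 5`; at `p = 3` the passage `Hom_Γ(Δ₀, k) ↔ H¹_c` must also
dispose of the order-`3` elliptic elements of `Γ₀(N)` — a typer's rider, not claimed here). NOT IN
PRINT when `p² ∣ N` — the exact missing statement of the TAM-DEFECT₂ corner `e_p ∈ {3,4,6}` of class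
X4. A predicate (typed target); nothing asserted.
[cite: Ribet1990, Thm. 5.2 (b)] [cite: Wiles1995, Thm. 2.1] [cite: Mazur1977, Prop. II.14.2] -/
def ModPMultiplicityOne (N : ℕ) (θ : ℕ → k) : Prop :=
  ∀ Φ Ψ : P1Q → P1Q → (Fin 1 → k), IsEigenPlusSymb k N θ Φ → IsEigenPlusSymb k N θ Ψ → Ψ ≠ 0 →
    ∃ c : k, Φ = c • Ψ

variable (k) in
/-- **(OLD) a NON-ZERO `ℓ`-OLD eigen-plus symbol with eigensystem `θ`**: the symbol of the `ℓ`-old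
function `r ↦ μ(r) − w·μ(ℓ r)` lies in `IsEigenPlusSymb k N θ` and is non-zero. IN PRINT for
`θ = θ̄_f`, `f` the newform of an elliptic curve with `ρ̄_{E,p}` absolutely irreducible and UNRAMIFIED
at `ℓ ∥ N` (e.g. `p ∣ c_ℓ(E)` at a split multiplicative `ℓ`, `w = a_ℓ = 1`): Ribet 1990 Thm. 1.1 /
Diamond 1995 Thm. 1.1 (level lowering: a newform `g` of level prime to `ℓ` with `ρ̄_g ≅ ρ̄_f`), the
`ℓ`-stabilisation `g − β g(ℓ·)` with `β/ℓ ≡ w`, `T_p`-eigenvalues matched by Deligne / Edixhoven 1992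
Thm. 2.5–2.6, `U`-eigenvalues at the other primes of `N` by stabilisation, and NON-vanishing mod `𝔭`
with `μ` integral by Ihara's lemma (Ribet 1984 Thm. 4.1). A predicate (typed target); nothing asserted.
[cite: Ribet1990, Thm. 1.1] [cite: Diamond1995RefinedSerre, Thm. 1.1] [cite: Ribet1984ICM, Thm. 4.1]
[cite: Edixhoven1992, Thm. 2.5 and 2.6] -/
def HasOldEigenPlusSymb (N : ℕ) (θ : ℕ → k) (ℓ : ℕ) (w : k) (μ : ℚ → k) : Prop :=
  IsEigenPlusSymb k N θ (potSymbOf fun r ↦ μ r - w * μ (ℓ * r)) ∧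
    potSymbOf (fun r ↦ μ r - w * μ (ℓ * r)) ≠ 0

end Predicates

/-! ### §2 `f`'s plus symbol, reduced mod `p` and read in `k`, lies in the `θ̄_f`-eigen plus subspace -/

section Reduction

variable {p : ℕ} [hp : Fact p.Prime] (ι : ZMod p →+* k) {N : ℕ} (f : CuspForm (Gamma0 N) 2)

/-- **`f`'s plus symbol reduced mod `p` and read in `k`**: the `Sym⁰ k`-valued symbol of
`r ↦ ι([r]⁺_f mod p)`. [cite: MazurTateTeitelbaum1986Invent, §I.8] -/
def redSymb : P1Q → P1Q → (Fin 1 → k) :=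
  potSymbOf fun r ↦ ι ((ratPlusSymbol f r : ℚ) : ZMod p)

variable {ι f}

/-- The reduction `ℚ → ℤ/p → k` of the tree's rational potential: `potOf (r ↦ ι([r]⁺ mod p)) x =
ι(ratPot f x mod p)`. [folklore] -/
theorem potOf_red_eq (x : P1Q) :
    potOf (fun r ↦ ι ((ratPlusSymbol f r : ℚ) : ZMod p)) x = ι ((ratPot f x : ℚ) : ZMod p) := by
  rcases P1Q.infty_or_ofRat x with rfl | ⟨r, rfl⟩
  · rw [potOf_infty, ratPot_infty, Rat.cast_zero, map_zero]
  · rw [potOf_ofRat, ratPot_ofRat]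

/-- Unfolding `redSymb` on the tree's rational potentials. [folklore] -/
theorem redSymb_apply (x y : P1Q) (i : Fin 1) :
    redSymb ι f x y i = ι ((ratPot f y : ℚ) : ZMod p) - ι ((ratPot f x : ℚ) : ZMod p) := by
  rw [redSymb, potSymbOf_apply, potOf_red_eq, potOf_red_eq]

/-- Casting a difference of `p`-integral rationals to `ℤ/p`. [folklore] -/
private theorem ratCast_sub_of_not_dvd {a b : ℚ} (ha : ¬ p ∣ a.den) (hb : ¬ p ∣ b.den) :
    ((a - b : ℚ) : ZMod p) = (a : ZMod p) - (b : ZMod p) := by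
  have ha' : (a.den : ZMod p) ≠ 0 := by rwa [Ne, ZMod.natCast_eq_zero_iff]
  have hb' : (b.den : ZMod p) ≠ 0 := by rwa [Ne, ZMod.natCast_eq_zero_iff]
  exact Rat.cast_sub_of_ne_zero ha' hb'

/-- Casting an integer multiple of a `p`-integral rational to `ℤ/p`. [folklore] -/
private theorem ratCast_intCast_mul_of_not_dvd (n : ℤ) {a : ℚ} (ha : ¬ p ∣ a.den) :
    (((n : ℚ) * a : ℚ) : ZMod p) = (n : ZMod p) * (a : ZMod p) := by
  have ha' : (a.den : ZMod p) ≠ 0 := by rwa [Ne, ZMod.natCast_eq_zero_iff]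
  have hn' : ((n : ℚ).den : ZMod p) ≠ 0 := by rw [Rat.den_intCast, Nat.cast_one]; exact one_ne_zero
  rw [Rat.cast_mul_of_ne_zero hn' ha', Rat.cast_intCast]

/-- The denominator of a sum of `p`-integral rationals is prime to `p`. [folklore] -/
private theorem not_dvd_den_add {a b : ℚ} (ha : ¬ p ∣ a.den) (hb : ¬ p ∣ b.den) :
    ¬ p ∣ (a + b).den := by
  intro h
  rcases (Nat.Prime.dvd_mul hp.out).mp (dvd_trans h (Rat.add_den_dvd a b)) with h1 | h2
  · exact ha h1
  · exact hb h2

/-- The denominator of a difference of `p`-integral rationals is prime to `p`. [folklore] -/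
private theorem not_dvd_den_sub {a b : ℚ} (ha : ¬ p ∣ a.den) (hb : ¬ p ∣ b.den) :
    ¬ p ∣ (a - b).den := by
  rw [sub_eq_add_neg]
  exact not_dvd_den_add ha (by rwa [Rat.den_neg_eq_den])

/-- The denominator of a finite sum of `p`-integral rationals is prime to `p`. [folklore] -/
private theorem not_dvd_den_sum {α : Type*} (s : Finset α) (g : α → ℚ)
    (hg : ∀ i ∈ s, ¬ p ∣ (g i).den) : ¬ p ∣ (∑ i ∈ s, g i).den := by
  classical
  induction s using Finset.induction_on with
  | empty =>
    rw [Finset.sum_empty, Rat.den_zero]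
    exact fun h ↦ hp.out.one_lt.ne' (Nat.dvd_one.mp h)
  | @insert a s has ih =>
    rw [Finset.sum_insert has]
    exact not_dvd_den_add (hg a (Finset.mem_insert_self a s))
      (ih fun i hi ↦ hg i (Finset.mem_insert_of_mem hi))

/-- Casting a `p`-integral finite sum to `ℤ/p`. [folklore] -/
private theorem ratCast_sum_of_not_dvd {α : Type*} (s : Finset α) (g : α → ℚ)
    (hg : ∀ i ∈ s, ¬ p ∣ (g i).den) :
    ((∑ i ∈ s, g i : ℚ) : ZMod p) = ∑ i ∈ s, ((g i : ℚ) : ZMod p) := by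
  classical
  induction s using Finset.induction_on with
  | empty => simp
  | @insert a s has ih =>
    have hs : ∀ i ∈ s, ¬ p ∣ (g i).den := fun i hi ↦ hg i (Finset.mem_insert_of_mem hi)
    have hga : ((g a).den : ZMod p) ≠ 0 := by
      rw [Ne, ZMod.natCast_eq_zero_iff]; exact hg a (Finset.mem_insert_self a s)
    have hsum : ((∑ i ∈ s, g i).den : ZMod p) ≠ 0 := by
      rw [Ne, ZMod.natCast_eq_zero_iff]; exact not_dvd_den_sum s g hs
    rw [Finset.sum_insert has, Finset.sum_insert has, Rat.cast_add_of_ne_zero hga hsum, ih hs]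

/-- The rational potential `ratPot f x` is `p`-integral when every `[r]⁺_f` is. [folklore] -/
private theorem not_dvd_den_ratPot (hint : ∀ r : ℚ, ¬ p ∣ (ratPlusSymbol f r).den) (x : P1Q) :
    ¬ p ∣ (ratPot f x).den := by
  rcases P1Q.infty_or_ofRat x with rfl | ⟨r, rfl⟩
  · rw [ratPot_infty, Rat.den_zero]; exact fun h ↦ hp.out.one_lt.ne' (Nat.dvd_one.mp h)
  · rw [ratPot_ofRat]; exact hint r

/-- **Reduction of a DIFFERENCE identity**: if `[y]⁺ − [x]⁺ = [y']⁺ − [x']⁺` in `ℚ` (all values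
`p`-integral) then the same holds for the reductions read in `k`. [folklore] -/
private theorem redSymb_eq_of_ratSymb_eq (hint : ∀ r : ℚ, ¬ p ∣ (ratPlusSymbol f r).den)
    {x y x' y' : P1Q} (h : ratPot f y - ratPot f x = ratPot f y' - ratPot f x') (i : Fin 1) :
    redSymb ι f x y i = redSymb ι f x' y' i := by
  rw [redSymb_apply, redSymb_apply, ← map_sub, ← map_sub,
    ← ratCast_sub_of_not_dvd (not_dvd_den_ratPot hint y) (not_dvd_den_ratPot hint x),
    ← ratCast_sub_of_not_dvd (not_dvd_den_ratPot hint y') (not_dvd_den_ratPot hint x'), h]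

/-- `ratPot f (ι x) = ratPot f x` for `ι = diag(−1,1)`. [folklore] -/
theorem ratPot_act_iotaMat (x : P1Q) : ratPot f (P1Q.act iotaMat x) = ratPot f x := by
  rcases P1Q.infty_or_ofRat x with rfl | ⟨r, rfl⟩
  · rw [P1Q.act_iotaMat_infty]
  · rw [P1Q.act_iotaMat_ofRat, ratPot_ofRat, ratPot_ofRat, ratPlusSymbol_neg]

variable [NeZero N]

/-- **`f`'s REDUCED PLUS SYMBOL LIES IN THE `θ̄_f`-EIGEN PLUS SUBSPACE.** For a normalised newform
`f ∈ S₂(Γ₀(N))` with rational coefficients (`hQ`), `Ω⁺_f ≠ 0`, integer Hecke eigenvalues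
`θ(q) = a_q(f)` at every prime `q` (`hθ`), and EVERY plus symbol `[r]⁺_f` `p`-integral (`hint`;
discharged for `E[p]` irreducible by `Additive.norm_ratPlusSymbol_le_one_of_irreducible`):
`redSymb ι f ∈ IsEigenPlusSymb k N (q ↦ ι(θ q mod p))`. Proof: the tree's `ratSymb_mem_Symb` and
`hecke_ratSymb` over `ℚ`, evenness `[−r]⁺ = [r]⁺`, and genuine reduction of the `p`-integral values
(the `Sym⁰` slash action only transports cusps, `symPowOn_zero_slash`).
[cite: MazurTateTeitelbaum1986Invent, §I.4 (4.2) and §I.8] -/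
theorem isEigenPlusSymb_redSymb (hf : IsNewform0 f) (hQ : coeffField f = ⊥) (hΩ : plusPeriod f ≠ 0)
    (hint : ∀ r : ℚ, ¬ p ∣ (ratPlusSymbol f r).den)
    (θ : ℕ → ℤ) (hθ : ∀ q : ℕ, q.Prime → ((θ q : ℤ) : ℂ) = cuspCoeff f q) :
    IsEigenPlusSymb k N (fun q ↦ ι ((θ q : ℤ) : ZMod p)) (redSymb ι f) := by
  have hS := ratSymb_mem_Symb f hf hQ hΩ
  refine ⟨⟨fun x y z ↦ ?_, fun γ hγ ↦ ?_⟩, fun q _ hq ↦ ?_, ?_⟩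
  · -- additivity
    funext i
    simp only [Pi.add_apply, redSymb_apply]
    ring
  · -- `Γ₀(N)`-invariance
    funext x y i
    rw [symPowOn_zero_slash]
    have h := congrFun (congrFun (congrFun (hS.2 γ hγ) x) y) i
    rw [symPowOn_zero_slash, ratSymb_apply, ratSymb_apply] at h
    exact redSymb_eq_of_ratSymb_eq hint h i
  · -- Hecke
    haveI : Fact q.Prime := ⟨hq⟩
    have hH := hecke_ratSymb f (p := q) hf hQ hΩ (ap := (θ q : ℚ))
      (by rw [Rat.cast_intCast]; exact hθ q hq)
    funext x y i
    have h := congrFun (congrFun (congrFun hH x) y) i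
    rw [CoeffActionOn.hecke_apply, Finset.sum_apply, Finset.sum_apply, Finset.sum_apply] at h ⊢
    simp only [symPowOn_zero_slash, ratSymb_apply, Pi.smul_apply, smul_eq_mul] at h
    simp only [symPowOn_zero_slash]
    have hx := not_dvd_den_ratPot (f := f) hint
    -- each term is the genuine reduction of a `p`-integral difference
    have hterm : ∀ j : HeckeIdx N q, redSymb ι f (P1Q.act (heckeRep q j.1) x)
        (P1Q.act (heckeRep q j.1) y) i =
        ι (((ratPot f (P1Q.act (heckeRep q j.1) y) - ratPot f (P1Q.act (heckeRep q j.1) x) : ℚ) :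
          ZMod p)) := fun j ↦ by
      rw [redSymb_apply, ← map_sub, ← ratCast_sub_of_not_dvd (hx _) (hx _)]
    rw [Finset.sum_congr rfl fun j _ ↦ hterm j, ← map_sum,
      ← ratCast_sum_of_not_dvd _ _ fun j _ ↦ not_dvd_den_sub (hx _) (hx _), h,
      ratCast_intCast_mul_of_not_dvd _ (not_dvd_den_sub (hx y) (hx x)), map_mul,
      ratCast_sub_of_not_dvd (hx y) (hx x), map_sub]
    simp only [Pi.smul_apply, smul_eq_mul, redSymb_apply]
  · -- plus
    funext x y i
    rw [symPowOn_zero_slash, redSymb_apply, redSymb_apply, ratPot_act_iotaMat, ratPot_act_iotaMat]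

end Reduction

/-! ### §3 The certificate from (MO) + (OLD) -/

section Main

variable {p : ℕ} [hp : Fact p.Prime] {ι : ZMod p →+* k} {N : ℕ} [NeZero N] {f : CuspForm (Gamma0 N) 2}

/-- A Hecke relation survives multiplication of the function by a constant. [folklore] -/
private theorem heckeRel_const_mul'' {R : Type*} [CommRing R] {ν : ℚ → R} {q : ℕ} {a : R}
    (h : HeckeRel ν q a) (c : R) : HeckeRel (fun r ↦ c * ν r) q a := fun r ↦ by
  have := congrArg (fun x ↦ c * x) (h r)
  simp only [mul_add, Finset.mul_sum] at this ⊢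
  rw [this]; ring

/-- **`[r]⁺_f ≡ c·(μ(r) − w·μ(ℓ r))` in `k` from (MO) + (OLD).** If the `θ̄_f`-eigen plus subspace of
`Symb_{Γ₀(N)}(Sym⁰ k)` has dimension `≤ 1` (`ModPMultiplicityOne`) and contains the NON-ZERO `ℓ`-old
symbol of `r ↦ μ(r) − w μ(ℓ r)` (`HasOldEigenPlusSymb`), then — since `f`'s reduced plus symbol lies
in the same subspace (`isEigenPlusSymb_redSymb`) — there is ONE constant `c ∈ k` with
`ι([r]⁺_f mod p) = c·(μ(r) − w·μ(ℓ r))` for every `r ∈ ℚ`. (`c = 0` is allowed: then every `[r]⁺_f`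
vanishes mod `p` and the certificate holds trivially.) [cite: Ribet1990, Thm. 1.1 and Thm. 5.2 (b)]
[cite: MazurTateTeitelbaum1986Invent, §I.8] -/
theorem exists_ratPlusSymbol_eq_mul_oldShape_of_multiplicityOne (hf : IsNewform0 f)
    (hQ : coeffField f = ⊥) (hΩ : plusPeriod f ≠ 0) (hint : ∀ r : ℚ, ¬ p ∣ (ratPlusSymbol f r).den)
    (θ : ℕ → ℤ) (hθ : ∀ q : ℕ, q.Prime → ((θ q : ℤ) : ℂ) = cuspCoeff f q)
    (hMO : ModPMultiplicityOne k N (fun q ↦ ι ((θ q : ℤ) : ZMod p)))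
    {ℓ : ℕ} {w : k} {μ : ℚ → k}
    (hOLD : HasOldEigenPlusSymb k N (fun q ↦ ι ((θ q : ℤ) : ZMod p)) ℓ w μ) :
    ∃ c : k, ∀ r : ℚ, ι ((ratPlusSymbol f r : ℚ) : ZMod p) = c * (μ r - w * μ (ℓ * r)) := by
  obtain ⟨c, hc⟩ := hMO _ _ (isEigenPlusSymb_redSymb (ι := ι) hf hQ hΩ hint θ hθ) hOLD.1 hOLD.2
  refine ⟨c, fun r ↦ ?_⟩
  have h := congrFun (congrFun (congrFun hc P1Q.infty) (P1Q.ofRat r)) 0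
  rw [Pi.smul_apply, Pi.smul_apply, Pi.smul_apply, smul_eq_mul, potSymbOf_infty_ofRat] at h
  rw [← h, redSymb, potSymbOf_infty_ofRat]

/-- **THE LEVEL-LOWERING CERTIFICATE FROM THE TWO PUBLISHED INPUTS (no twist: `p ∤ N` classes, or
the cell's twist `V` itself).** For the newform `f ∈ S₂(Γ₀(N))` (rational, `Ω⁺_f ≠ 0`, integer
eigenvalues `θ`, every `[r]⁺_f` `p`-integral), a globally minimal `W/ℚ` whose good Frobenius traces at
the Kolyvagin primes of `(W, p)` are `θ` (`hW` — e.g. `f = f_W`), mod-`p` MULTIPLICITY ONE for the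
`θ̄`-eigen plus symbols of level `N` (`hMO`, in print for `p ∤ 2N`), and a NON-ZERO `ℓ`-OLD eigen-plus
symbol `μ − μ∘[ℓ]` with `μ` `1`-periodic and `T_q`-eigen (`θ̄(q)`) at those Kolyvagin primes (`hOLD`,
`hμ`, `hH` — Ribet + Ihara, in print when `ρ̄` is unramified at `ℓ ∥ N`, `a_ℓ = 1`):
**`PlusSymbolLevelLowersOver W p f ι ℓ`** — hence `∂^{(∞)} ≥ 1` and, on unit rows with
`ord_p ∏ c ≤ 2` at `p ≥ 5`, `BSD(E,p)` from published inputs (`X4/KuriharaLevelLoweringField.lean` §2, §4).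
[cite: Ribet1990, Thm. 1.1 and Thm. 5.2 (b)] [cite: Wiles1995, Thm. 2.1] [cite: Ribet1984ICM, Thm. 4.1]
[cite: Kim2022StructureSelmer, §1.2.2 and §1.4.3] -/
theorem plusSymbolLevelLowersOver_of_multiplicityOne (W : WeierstrassCurve ℚ) [W.IsGloballyMinimal]
    (hf : IsNewform0 f) (hQ : coeffField f = ⊥) (hΩ : plusPeriod f ≠ 0)
    (hint : ∀ r : ℚ, ¬ p ∣ (ratPlusSymbol f r).den)
    (θ : ℕ → ℤ) (hθ : ∀ q : ℕ, q.Prime → ((θ q : ℤ) : ℂ) = cuspCoeff f q)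
    (hW : ∀ q : ℕ, Kato.IsKolyvaginPrime W p 1 q → (W.frobeniusTrace q : ZMod p) = ((θ q : ℤ) : ZMod p))
    (hMO : ModPMultiplicityOne k N (fun q ↦ ι ((θ q : ℤ) : ZMod p)))
    {ℓ : ℕ} {μ : ℚ → k} (hOLD : HasOldEigenPlusSymb k N (fun q ↦ ι ((θ q : ℤ) : ZMod p)) ℓ 1 μ)
    (hμ : IsPeriodic μ)
    (hH : ∀ q : ℕ, Kato.IsKolyvaginPrime W p 1 q → HeckeRel μ q (ι ((θ q : ℤ) : ZMod p))) :
    PlusSymbolLevelLowersOver W p f ι ℓ := by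
  obtain ⟨c, hc⟩ :=
    exists_ratPlusSymbol_eq_mul_oldShape_of_multiplicityOne hf hQ hΩ hint θ hθ hMO hOLD
  refine ⟨fun r ↦ c * μ r, fun r z ↦ by simp only [hμ r z], fun q hq ↦ ?_, fun r ↦ ?_⟩
  · rw [hW q hq]
    exact heckeRel_const_mul'' (hH q hq) c
  · rw [hc r, one_mul, mul_sub]

/-- **The `V`-side OLD SHAPE for the twist transport, from (MO) + (OLD) on the twist.** Same inputs
for the newform `f = f_V` of the semistable / good twist `V` of the cell's additive `W = V ⊗ χ`
(conductor `N = N_V`, `p ∤ N_V` on the twist-good locus, so (MO) and (OLD) are in print there), with a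
general stabilisation sign `w` (`w·χ(ℓ) = 1` downstream): the function `φ(r) := ι([r]⁺_{f_V} mod p)`
has the shape `φ = μ' − w·μ'∘[ℓ]` with `μ' = c·μ` periodic and `T_q`-eigen — exactly the hypothesis
`hV` of `plusSymbolLevelLowersOver_of_twistSum_fn` (`X4/KuriharaLevelLoweringField.lean` §3), which
then yields `PlusSymbolLevelLowersOver W p f_W ι ℓ` for the additive curve.
[cite: Ribet1990, Thm. 1.1 and Thm. 5.2 (b)] [cite: Kim2022StructureSelmer, §1.2.2 and §1.4.3] -/
theorem exists_oldShape_of_multiplicityOne_twist (hf : IsNewform0 f) (hQ : coeffField f = ⊥)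
    (hΩ : plusPeriod f ≠ 0) (hint : ∀ r : ℚ, ¬ p ∣ (ratPlusSymbol f r).den)
    (θ : ℕ → ℤ) (hθ : ∀ q : ℕ, q.Prime → ((θ q : ℤ) : ℂ) = cuspCoeff f q)
    (hMO : ModPMultiplicityOne k N (fun q ↦ ι ((θ q : ℤ) : ZMod p)))
    {ℓ : ℕ} {w : k} {μ : ℚ → k}
    (hOLD : HasOldEigenPlusSymb k N (fun q ↦ ι ((θ q : ℤ) : ZMod p)) ℓ w μ) (hμ : IsPeriodic μ)
    {P : ℕ → Prop} (hH : ∀ q : ℕ, P q → HeckeRel μ q (ι ((θ q : ℤ) : ZMod p))) :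
    ∃ μ' : ℚ → k, IsPeriodic μ' ∧ (∀ q : ℕ, P q → HeckeRel μ' q (ι ((θ q : ℤ) : ZMod p))) ∧
      ∀ r : ℚ, ι ((ratPlusSymbol f r : ℚ) : ZMod p) = μ' r - w * μ' (ℓ * r) := by
  obtain ⟨c, hc⟩ :=
    exists_ratPlusSymbol_eq_mul_oldShape_of_multiplicityOne hf hQ hΩ hint θ hθ hMO hOLD
  refine ⟨fun r ↦ c * μ r, fun r z ↦ by simp only [hμ r z], fun q hq ↦ heckeRel_const_mul'' (hH q hq) c,
    fun r ↦ ?_⟩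
  rw [hc r]
  ring

end Main

end Summit.BirchSwinnertonDyer.Rank1Residual.LevelLowering

end
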